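import Summits.CriticalPhenomena.PercolationContinuityZ3.Theorems.Transplant.SkeletonKernelGenerators
import Mathlib.Data.Set.Finite.Lemmas
import Mathlib.Tactic.LinearCombination
import Mathlib.Tactic.Linarith
import HarnessLib

/-!
# RIGIDITY of planar skeletons on Cayley graphs under point reflections through standard symmetries: a bounded re-coordinatisation of an
# additive skeleton that is reflected at EVERY vertex by `g ↦ v·δ(v⁻¹g)` (`δ` an endomorphism) is additive up to a constant

builds on p205010 (kernel theorem, internal audit signed; external expert review pending) — nothing in this file uses p205010; pure group theory.
Lane `prim-bschramm`, seat `prim-bschramm-p4` gen 12 (PART C3 of `P4-GENERAL.md`, §34.4 (a): why residual (κ) cannot be reached by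
re-coordinatisation); helper file (`--supports stmt-CriticalPhenomena-4575 --as helper`).

THE QUESTION.  The closed `{±1}` node asks, on a Cayley graph `Cay(Γ;S)` with an additive skeleton `φ`, that the unit cylinder `C_1` be connected;
for the letters-only free nilpotent groups of class `≥ 4` it is not (P4-GENERAL §33.1).  Could a cleverer, NON-additive skeleton `φ' = c + β`
(`c` additive, `β` a bounded "twist", e.g. constant on the cosets of a finite-index subgroup) have connected unit cylinders and still satisfy the
interface?  The interface's axioms `frame` + `neg` give at EVERY vertex `v` a graph automorphism fixing `v` and reversing `φ'` about `φ'(v)`; when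
frames and reflections are taken in the standard symmetry group `Γ_L ⋊ Aut(Γ,S)` (left translations and `S`-preserving automorphisms — the only
ones any file of the lane uses), the reflection at `v` is `g ↦ v·δ_v(v⁻¹g)` with `δ_v ∈ End(Γ)`.  THIS FILE: then `β` is CONSTANT
(`CayleyRigidity.sub_eq_of_reflections`), i.e. `φ' − φ'(1)` is additive — so the cylinders of `φ'` are those of an additive skeleton and (κ) is
decided by `C_1` exactly as before.  Proof: (1) comparing the reflection identity `φ'(vδ(v⁻¹g)) = 2φ'(v) − φ'(g)` with `φ' = c + β` shows that the
additive map `c∘δ + c` has finite range, hence vanishes (`eq_zero_of_additive_of_finite_range`: `h(gⁿ) = n•h(g)`); (2) then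
`β(vδ(v⁻¹g)) + β(g) = 2β(v)` for all `v, g`; (3) at a vertex `v` maximising a coordinate of `β` both terms are `≤` the maximum and sum to twice
it, so `β(g)` attains the maximum for EVERY `g`.  No generating set, connectivity or nilpotency is needed for (1)–(3); nilpotency enters only in
the remark that for finitely generated nilpotent `Γ` every skeleton translated by a finite-index subgroup of left translations IS of the form
`c + β` (Mal'cev rigidity of `H¹(·;ℚ)`, not formalised here).
[cite: KozmaNitzan2024, §4 p. 16 (Lemma 8: the role of the lattice symmetries)] [cite: BenjaminiSchramm1996, §2 (Cayley graphs)]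
-/

namespace Summit.CriticalPhenomena.PercolationContinuityZ3.Theorems.Transplant

namespace CayleyRigidity

variable {Γ : Type*} [Group Γ]

/-- **An additive map `Γ → ℤ²` with finite range vanishes** (`h(gⁿ) = n • h(g)` would be injective in `n`). [folklore] -/
theorem eq_zero_of_additive_of_finite_range (h : Γ → (Fin 2 → ℤ)) (hadd : ∀ a b, h (a * b) = h a + h b)
    (hfin : (Set.range h).Finite) (g : Γ) : h g = 0 := by
  by_contra hne
  obtain ⟨i, hi⟩ : ∃ i, h g i ≠ 0 := Function.ne_iff.1 hne
  have hpow : ∀ n : ℕ, h (g ^ n) = n • h g := by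
    intro n
    induction n with
    | zero => rw [pow_zero, zero_smul]; exact KerGen.phi_one h hadd
    | succ n ih => rw [pow_succ, hadd, ih, succ_nsmul]
  have hinj : Function.Injective fun n : ℕ => h (g ^ n) := by
    intro n m hnm
    have e := congr_fun hnm i
    simp only [hpow, Pi.smul_apply, nsmul_eq_mul] at e
    exact_mod_cast mul_right_cancel₀ hi e
  haveI : Finite (Set.range h) := hfin.to_subtype
  exact not_injective_infinite_finite (fun n : ℕ => (⟨h (g ^ n), g ^ n, rfl⟩ : Set.range h))
    (fun n m hnm => hinj (congrArg Subtype.val hnm))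

/-- **Steps (1)–(2): the reflection identity passes to the bounded part.**  If `φ' = c + β` (`c` additive, `β` of finite range) is reflected at
`v` through `g ↦ v·δ(v⁻¹g)` (`δ` an endomorphism), then `c∘δ = −c` and `β(vδ(v⁻¹g)) + β(g) = 2β(v)` for all `g`. [folklore] -/
theorem twist_reflection (φ' c : Γ → (Fin 2 → ℤ)) (hc : ∀ a b, c (a * b) = c a + c b)
    (hβ : (Set.range fun g => φ' g - c g).Finite) (v : Γ) (δ : Γ →* Γ)
    (hδ : ∀ g, φ' (v * δ (v⁻¹ * g)) = 2 • φ' v - φ' g) (g : Γ) :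
    c (δ g) + c g = 0 ∧ (φ' (v * δ (v⁻¹ * g)) - c (v * δ (v⁻¹ * g))) + (φ' g - c g) = 2 • (φ' v - c v) := by
  have cinv : ∀ x, c x⁻¹ = -c x := KerGen.phi_inv c hc
  -- expansion of the additive part at the reflected point
  have ec : ∀ x, c (v * δ (v⁻¹ * x)) = c v - c (δ v) + c (δ x) := by
    intro x; rw [hc, map_mul, hc, map_inv, cinv]; abel
  -- (1) `c∘δ + c` has finite range, hence vanishes
  have hfin : (Set.range fun x => c (δ x) + c x).Finite := by
    refine (Set.Finite.image2 (fun a b => (c v + c (δ v) + 2 • (φ' v - c v)) - a - b) hβ hβ).subset ?_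
    rintro _ ⟨x, rfl⟩
    refine ⟨φ' x - c x, ⟨x, rfl⟩, φ' (v * δ (v⁻¹ * x)) - c (v * δ (v⁻¹ * x)), ⟨_, rfl⟩, ?_⟩
    have h := hδ x
    rw [ec x]
    rw [two_nsmul] at h ⊢
    linear_combination (exp := 1) -h
  have hzero : ∀ x, c (δ x) + c x = 0 :=
    eq_zero_of_additive_of_finite_range (fun x => c (δ x) + c x) (fun a b => by
      show c (δ (a * b)) + c (a * b) = (c (δ a) + c a) + (c (δ b) + c b)
      rw [map_mul, hc, hc]; abel) hfin
  refine ⟨hzero g, ?_⟩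
  -- (2) the identity for `β`
  have h := hδ g
  have hv := hzero v
  have hg := hzero g
  rw [ec g]
  rw [two_nsmul] at h ⊢
  linear_combination (exp := 1) h + hv - hg

/-- **RIGIDITY THEOREM: a finite-range twist of an additive skeleton that is point-reflected at every vertex through standard symmetries is
CONSTANT** — `φ'(g) − c(g) = φ'(1)` for all `g`, i.e. `φ' − φ'(1)` is additive.  Hypotheses: `c` additive, `β = φ' − c` of finite range, and for
every `v` an endomorphism `δ_v` of `Γ` with `φ'(v·δ_v(v⁻¹g)) = 2φ'(v) − φ'(g)` for all `g` (the reflection at `v` realised in `Γ_L ⋊ End(Γ)`).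
No generating set, connectivity or nilpotency is used. [cite: KozmaNitzan2024, §4 p. 16 (Lemma 8)] -/
theorem sub_eq_of_reflections (φ' c : Γ → (Fin 2 → ℤ)) (hc : ∀ a b, c (a * b) = c a + c b)
    (hβ : (Set.range fun g => φ' g - c g).Finite)
    (hrefl : ∀ v : Γ, ∃ δ : Γ →* Γ, ∀ g, φ' (v * δ (v⁻¹ * g)) = 2 • φ' v - φ' g) (g : Γ) :
    φ' g - c g = φ' 1 := by
  set β : Γ → (Fin 2 → ℤ) := fun x => φ' x - c x with hβdef
  have c1 : c 1 = 0 := KerGen.phi_one c hc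
  -- (2) at every vertex
  have key : ∀ v : Γ, ∃ δ : Γ →* Γ, ∀ x, β (v * δ (v⁻¹ * x)) + β x = 2 • β v := by
    intro v
    obtain ⟨δ, hδ⟩ := hrefl v
    exact ⟨δ, fun x => (twist_reflection φ' c hc hβ v δ hδ x).2⟩
  -- (3) maximum principle, coordinate by coordinate
  have hconst : ∀ i : Fin 2, ∀ x, β x i = β 1 i := by
    intro i
    have hfinI : (Set.range fun x => β x i).Finite :=
      (hβ.image fun y => y i).subset (by rintro _ ⟨x, rfl⟩; exact ⟨β x, ⟨x, rfl⟩, rfl⟩)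
    obtain ⟨M, ⟨v, hv⟩, hmax⟩ := Set.exists_max_image (Set.range fun x => β x i) id hfinI ⟨β 1 i, 1, rfl⟩
    simp only [id] at hmax hv
    have hall : ∀ x, β x i = M := by
      intro x
      obtain ⟨δ, hδ⟩ := key v
      have h1 := congr_fun (hδ x) i
      simp only [Pi.add_apply, Pi.smul_apply, nsmul_eq_mul, Nat.cast_ofNat, hv] at h1
      have h2 := hmax _ ⟨v * δ (v⁻¹ * x), rfl⟩
      have h3 := hmax _ ⟨x, rfl⟩
      simp only at h2 h3
      omega
    intro x
    rw [hall x, hall 1]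
  have hb : β g = β 1 := funext fun i => hconst i g
  have hb1 : β 1 = φ' 1 := by simp only [hβdef, c1, sub_zero]
  rw [← hb1, ← hb]

/-- **COROLLARY (the form used in P4-GENERAL §34.4 (a)): such a `φ'` is an additive map plus the constant `φ'(1)`**, so its relative cylinders
`{g : φ'(g) − φ'(1) ∈ Λ_ℓ}` are the cylinders `{g : c(g) ∈ Λ_ℓ}` of the additive skeleton `c`. [folklore] -/
theorem eq_add_of_reflections (φ' c : Γ → (Fin 2 → ℤ)) (hc : ∀ a b, c (a * b) = c a + c b)
    (hβ : (Set.range fun g => φ' g - c g).Finite)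
    (hrefl : ∀ v : Γ, ∃ δ : Γ →* Γ, ∀ g, φ' (v * δ (v⁻¹ * g)) = 2 • φ' v - φ' g) (g : Γ) :
    φ' g - φ' 1 = c g := by
  have h := sub_eq_of_reflections φ' c hc hβ hrefl g
  linear_combination (exp := 1) h

/-! ## §2 Rational additive parts (twists of `A·φ` with `A` a rational matrix, e.g. meandering letter lines of drift `1/2`) -/

/-- **An additive map `Γ → ℚ²` with finite range vanishes.** [folklore] -/
theorem eq_zero_of_additive_of_finite_range_rat (h : Γ → (Fin 2 → ℚ)) (hadd : ∀ a b, h (a * b) = h a + h b)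
    (hfin : (Set.range h).Finite) (g : Γ) : h g = 0 := by
  by_contra hne
  obtain ⟨i, hi⟩ : ∃ i, h g i ≠ 0 := Function.ne_iff.1 hne
  have h1 : h 1 = 0 := by
    have e := hadd 1 1
    rw [one_mul] at e
    exact left_eq_add.1 e
  have hpow : ∀ n : ℕ, h (g ^ n) = n • h g := by
    intro n
    induction n with
    | zero => rw [pow_zero, zero_smul]; exact h1
    | succ n ih => rw [pow_succ, hadd, ih, succ_nsmul]
  have hinj : Function.Injective fun n : ℕ => h (g ^ n) := by
    intro n m hnm
    have e := congr_fun hnm i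
    simp only [hpow, Pi.smul_apply, nsmul_eq_mul] at e
    exact_mod_cast mul_right_cancel₀ hi e
  haveI : Finite (Set.range h) := hfin.to_subtype
  exact not_injective_infinite_finite (fun n : ℕ => (⟨h (g ^ n), g ^ n, rfl⟩ : Set.range h))
    (fun n m hnm => hinj (congrArg Subtype.val hnm))

/-- **Rational version of `twist_reflection`**: `φ' = c + β` with `c : Γ → ℚ²` additive and `β` of finite range, reflected at `v` through
`g ↦ v·δ(v⁻¹g)`; then `c∘δ = −c` and `β(vδ(v⁻¹g)) + β(g) = 2β(v)`. [folklore] -/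
theorem twist_reflection_rat (φ' c : Γ → (Fin 2 → ℚ)) (hc : ∀ a b, c (a * b) = c a + c b)
    (hβ : (Set.range fun g => φ' g - c g).Finite) (v : Γ) (δ : Γ →* Γ)
    (hδ : ∀ g, φ' (v * δ (v⁻¹ * g)) = 2 • φ' v - φ' g) (g : Γ) :
    c (δ g) + c g = 0 ∧ (φ' (v * δ (v⁻¹ * g)) - c (v * δ (v⁻¹ * g))) + (φ' g - c g) = 2 • (φ' v - c v) := by
  have c1 : c 1 = 0 := by
    have e := hc 1 1
    rw [one_mul] at e
    exact left_eq_add.1 e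
  have cinv : ∀ x, c x⁻¹ = -c x := fun x => by
    have e := hc x⁻¹ x
    rw [inv_mul_cancel, c1] at e
    exact eq_neg_of_add_eq_zero_left e.symm
  have ec : ∀ x, c (v * δ (v⁻¹ * x)) = c v - c (δ v) + c (δ x) := by
    intro x; rw [hc, map_mul, hc, map_inv, cinv]; abel
  have hfin : (Set.range fun x => c (δ x) + c x).Finite := by
    refine (Set.Finite.image2 (fun a b => (c v + c (δ v) + 2 • (φ' v - c v)) - a - b) hβ hβ).subset ?_
    rintro _ ⟨x, rfl⟩
    refine ⟨φ' x - c x, ⟨x, rfl⟩, φ' (v * δ (v⁻¹ * x)) - c (v * δ (v⁻¹ * x)), ⟨_, rfl⟩, ?_⟩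
    have h := hδ x
    rw [ec x]
    rw [two_nsmul] at h ⊢
    linear_combination (exp := 1) -h
  have hzero : ∀ x, c (δ x) + c x = 0 :=
    eq_zero_of_additive_of_finite_range_rat (fun x => c (δ x) + c x) (fun a b => by
      show c (δ (a * b)) + c (a * b) = (c (δ a) + c a) + (c (δ b) + c b)
      rw [map_mul, hc, hc]; abel) hfin
  refine ⟨hzero g, ?_⟩
  have h := hδ g
  have hv := hzero v
  have hg := hzero g
  rw [ec g]
  rw [two_nsmul] at h ⊢
  linear_combination (exp := 1) h + hv - hg

/-- **RIGIDITY THEOREM, rational additive part**: if `φ' : Γ → ℚ²` (e.g. an integer skeleton cast to `ℚ²`) equals `c + β` with `c` additive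
`ℚ²`-valued and `β` of finite range, and at every `v` some endomorphism `δ_v` reflects `φ'` through `g ↦ v·δ_v(v⁻¹g)`, then `β` is constant:
`φ'(g) − c(g) = φ'(1)`.  This covers twists of `A·φ` for a rational matrix `A` (letter lines meandering with fractional drift).
[cite: KozmaNitzan2024, §4 p. 16 (Lemma 8)] -/
theorem sub_eq_of_reflections_rat (φ' c : Γ → (Fin 2 → ℚ)) (hc : ∀ a b, c (a * b) = c a + c b)
    (hβ : (Set.range fun g => φ' g - c g).Finite)
    (hrefl : ∀ v : Γ, ∃ δ : Γ →* Γ, ∀ g, φ' (v * δ (v⁻¹ * g)) = 2 • φ' v - φ' g) (g : Γ) :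
    φ' g - c g = φ' 1 := by
  set β : Γ → (Fin 2 → ℚ) := fun x => φ' x - c x with hβdef
  have c1 : c 1 = 0 := by
    have e := hc 1 1
    rw [one_mul] at e
    exact left_eq_add.1 e
  have key : ∀ v : Γ, ∃ δ : Γ →* Γ, ∀ x, β (v * δ (v⁻¹ * x)) + β x = 2 • β v := by
    intro v
    obtain ⟨δ, hδ⟩ := hrefl v
    exact ⟨δ, fun x => (twist_reflection_rat φ' c hc hβ v δ hδ x).2⟩
  have hconst : ∀ i : Fin 2, ∀ x, β x i = β 1 i := by
    intro i
    have hfinI : (Set.range fun x => β x i).Finite :=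
      (hβ.image fun y => y i).subset (by rintro _ ⟨x, rfl⟩; exact ⟨β x, ⟨x, rfl⟩, rfl⟩)
    obtain ⟨M, ⟨v, hv⟩, hmax⟩ := Set.exists_max_image (Set.range fun x => β x i) id hfinI ⟨β 1 i, 1, rfl⟩
    simp only [id] at hmax hv
    have hall : ∀ x, β x i = M := by
      intro x
      obtain ⟨δ, hδ⟩ := key v
      have h1 := congr_fun (hδ x) i
      simp only [Pi.add_apply, Pi.smul_apply, nsmul_eq_mul, Nat.cast_ofNat, hv] at h1
      have h2 := hmax _ ⟨v * δ (v⁻¹ * x), rfl⟩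
      have h3 := hmax _ ⟨x, rfl⟩
      simp only at h2 h3
      linarith
    intro x
    rw [hall x, hall 1]
  have hb : β g = β 1 := funext fun i => hconst i g
  have hb1 : β 1 = φ' 1 := by simp only [hβdef, c1, sub_zero]
  rw [← hb1, ← hb]

end CayleyRigidity

end Summit.CriticalPhenomena.PercolationContinuityZ3.Theorems.Transplant
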